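import Summits.RiemannHypothesis.RiemannHypothesis.Theses.WeilComb
import Literature.NumberTheory.LFunctions.WeilExplicit
import Literature.NumberTheory.LFunctions.WeilMellinBounds

/-!
# The Dirichlet–Fejér identity behind `stub_fejer` (C⁺) of line `Sketch`
(item stmt-RiemannHypothesis-11229, crux `WeilComb.CombShapePositivity`, route route-RiemannHypothesis-WeilComb;
siege variation k6: explicit finite sums / Dirichlet–Fejér identity by induction)

Notation: `N = ∏_{p∈S} p^n` (divisor box), `χ_θ(d) = exp(i Σ_{p∈S} θ_p v_p(d))` (Bohr character of the torus
`T^S` read on the box), `w : ℝ → ℂ` any symbol (in the stub: the comb symbol `w_ε(x) = W(τ_x (φ_ε ⋆ φ̃_ε))`),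
box form `B(w) = Σ_{d, d' ∣ N} χ_θ(d) conj χ_θ(d') w(log d − log d')`. All results are unconditional bookkeeping:

* `sum_divisors_sum_divisors_eq_sum_coprime` — gcd reparametrisation of pairs of divisors of any `N`:
  `(d, d') ↦ ((d/g, d'/g), g)`, `g = gcd(d, d')`, is a bijection onto `{((a, b), e) : gcd(a,b) = 1, ab ∣ N, e ∣ N/(ab)}`.
* `boxForm_eq_sum_coprime` — for multiplicative unimodular `χ` and ANY `w`, `B(w)` compresses to the difference
  set `{a/b : gcd(a,b) = 1, ab ∣ N}` with FEJÉR MULTIPLICITIES `τ(N/(ab))`.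
* `card_divisors_primeBox_div` — on the prime box these are the Fejér kernel weights
  `τ(N/(ab)) = ∏_{p∈S} (n + 1 − v_p(a) − v_p(b)) = ∏_p (n + 1 − |h_p|)`, `h = v(a) − v(b) ∈ [−n, n]^S`.
* `stubFejer_lhs_eq_fejerSum` — the left-hand side of the registered stub `stub_fejer`, verbatim, is the Fejér
  mean `Σ_{h ∈ [−n,n]^S} ∏_p (n+1−|h_p|) e^{i⟨θ,h⟩} w_ε(⟨h, log p⟩)` (written on coprime pairs): C⁺ says that the
  Fejér means of the Fourier series `Σ_h w_ε(⟨h, log p⟩) e^{i⟨θ,h⟩}` of the comb symbol on every torus are `≥ 0`.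
* `sum_range_sum_range_eq_sum_fejer` (1-D Dirichlet → Fejér by induction on `n`) and `stubFejer_lhs_single_prime`
  (the slice `S = {p}`: `Σ_{|h| ≤ n} (n+1−|h|) e^{ihθ_p} w_ε(h log p)`).

Why the identity cannot sign the form (census of this variation): the weights are the Fourier coefficients of
the nonnegative Fejér kernel, so `B ≥ 0` for all boxes and all `θ` is equivalent (Herglotz–Bochner on `ℤ^S`; in
the tree `stub_reduction`, p86541) to positive definiteness of `q ↦ w_ε(log q)` on `ℚ_{>0}` — the crux itself
(`WeilCombBohrFejer.combShapePositivity_iff_fejer`), kernel-checked equivalent to `RiemannHypothesis`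
(`WeilCombFejerConvSquare.fejer_iff_riemannHypothesis`). The identity is the bookkeeping half of the Bohr–Fejér
line; the sign is RH.
-/

noncomputable section

-- the sub-problem path RiemannHypothesis/RiemannHypothesis duplicates a namespace (D-0017)
set_option linter.dupNamespace false

open scoped BigOperators ComplexConjugate
open Complex

namespace Summit.RiemannHypothesis.RiemannHypothesis.Theorems.WeilCombFejerBoxIdentity

open Literature.NumberTheory.LFunctions

/-! ## gcd reparametrisation of pairs of divisors -/

/-- For divisors `d, d'` of `N` with `g = gcd(d, d')`: the reduced pair `(d/g, d'/g)` is coprime, its product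
divides `N`, and `g` divides `N / ((d/g)(d'/g))` (i.e. `lcm(d, d') = (d/g)(d'/g) g ∣ N`). [folklore] -/
theorem reducedPair_spec {N d d' : ℕ} (hd : d ∈ N.divisors) (hd' : d' ∈ N.divisors) :
    (d / d.gcd d').Coprime (d' / d.gcd d') ∧ d / d.gcd d' * (d' / d.gcd d') ∣ N ∧
      d.gcd d' ∣ N / (d / d.gcd d' * (d' / d.gcd d')) := by
  obtain ⟨hdN, -⟩ := Nat.mem_divisors.1 hd
  obtain ⟨hd'N, -⟩ := Nat.mem_divisors.1 hd'
  have hd0 : 0 < d := Nat.pos_of_mem_divisors hd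
  set g := d.gcd d' with hg
  have hg0 : 0 < g := Nat.gcd_pos_of_pos_left d' hd0
  have hcop : (d / g).Coprime (d' / g) := Nat.coprime_div_gcd_div_gcd hg0
  have hgN : g ∣ N := dvd_trans (Nat.gcd_dvd_left d d') hdN
  have ha : d / g ∣ N / g :=
    Nat.dvd_div_of_mul_dvd (by rwa [Nat.mul_div_cancel' (Nat.gcd_dvd_left d d')])
  have hb : d' / g ∣ N / g :=
    Nat.dvd_div_of_mul_dvd (by rwa [Nat.mul_div_cancel' (Nat.gcd_dvd_right d d')])
  have hab : d / g * (d' / g) ∣ N / g := hcop.mul_dvd_of_dvd_of_dvd ha hb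
  have h3 : g * (d / g * (d' / g)) ∣ N := Nat.mul_dvd_of_dvd_div hgN hab
  refine ⟨hcop, dvd_trans (dvd_mul_left _ g) h3, Nat.dvd_div_of_mul_dvd ?_⟩
  rwa [mul_comm] at h3

/-- **gcd reparametrisation of pairs of divisors.** For any `N` and any `F`,
`Σ_{d, d' ∣ N} F(d, d') = Σ_{a, b ∣ N, gcd(a,b)=1, ab ∣ N} Σ_{e ∣ N/(ab)} F(ae, be)`:
the map `(d, d') ↦ ((d/g, d'/g), g)`, `g = gcd(d,d')`, is a bijection with inverse `((a,b), e) ↦ (ae, be)`.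
[folklore] -/
theorem sum_divisors_sum_divisors_eq_sum_coprime {M : Type*} [AddCommMonoid M] (N : ℕ) (F : ℕ → ℕ → M) :
    ∑ d ∈ N.divisors, ∑ d' ∈ N.divisors, F d d' =
      ∑ a ∈ N.divisors, ∑ b ∈ N.divisors,
        if a.Coprime b ∧ a * b ∣ N then ∑ e ∈ (N / (a * b)).divisors, F (a * e) (b * e) else 0 := by
  classical
  have hL : ∑ d ∈ N.divisors, ∑ d' ∈ N.divisors, F d d' = ∑ x ∈ N.divisors ×ˢ N.divisors, F x.1 x.2 :=
    (Finset.sum_product' N.divisors N.divisors F).symm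
  have hR : (∑ a ∈ N.divisors, ∑ b ∈ N.divisors,
        if a.Coprime b ∧ a * b ∣ N then ∑ e ∈ (N / (a * b)).divisors, F (a * e) (b * e) else 0) =
      ∑ y ∈ ((N.divisors ×ˢ N.divisors).filter (fun x : ℕ × ℕ => x.1.Coprime x.2 ∧ x.1 * x.2 ∣ N)).sigma
          (fun x : ℕ × ℕ => (N / (x.1 * x.2)).divisors), F (y.1.1 * y.2) (y.1.2 * y.2) := by
    rw [Finset.sum_sigma, Finset.sum_filter, Finset.sum_product]
  rw [hL, hR]
  refine Finset.sum_nbij'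
    (fun x : ℕ × ℕ => (⟨(x.1 / x.1.gcd x.2, x.2 / x.1.gcd x.2), x.1.gcd x.2⟩ : (_ : ℕ × ℕ) × ℕ))
    (fun y => (y.1.1 * y.2, y.1.2 * y.2)) ?_ ?_ ?_ ?_ ?_
  · -- the reduced triple lies in the target set
    rintro ⟨d, d'⟩ hx
    obtain ⟨hd, hd'⟩ := Finset.mem_product.1 hx
    have hN : N ≠ 0 := (Nat.mem_divisors.1 hd).2
    obtain ⟨hcop, hab, hg⟩ := reducedPair_spec hd hd'
    simp only [Finset.mem_sigma, Finset.mem_filter, Finset.mem_product, Nat.mem_divisors]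
    refine ⟨⟨⟨⟨?_, hN⟩, ⟨?_, hN⟩⟩, hcop, hab⟩, hg, ?_⟩
    · exact dvd_trans (Nat.div_dvd_of_dvd (Nat.gcd_dvd_left d d')) (Nat.mem_divisors.1 hd).1
    · exact dvd_trans (Nat.div_dvd_of_dvd (Nat.gcd_dvd_right d d')) (Nat.mem_divisors.1 hd').1
    · exact (Nat.div_pos (Nat.le_of_dvd (Nat.pos_of_ne_zero hN) hab)
        (Nat.pos_of_dvd_of_pos hab (Nat.pos_of_ne_zero hN))).ne'
  · -- the product pair lies in `D × D`
    rintro ⟨⟨a, b⟩, e⟩ hy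
    simp only [Finset.mem_sigma, Finset.mem_filter, Finset.mem_product, Nat.mem_divisors] at hy
    obtain ⟨⟨⟨⟨-, hN⟩, -⟩, -, hab⟩, he, -⟩ := hy
    have habe : a * b * e ∣ N := Nat.mul_dvd_of_dvd_div hab he
    simp only [Finset.mem_product, Nat.mem_divisors]
    exact ⟨⟨dvd_trans (Dvd.intro b (by ring)) habe, hN⟩, ⟨dvd_trans (Dvd.intro a (by ring)) habe, hN⟩⟩
  · -- left inverse
    rintro ⟨d, d'⟩ -
    show (d / d.gcd d' * d.gcd d', d' / d.gcd d' * d.gcd d') = (d, d')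
    rw [Nat.div_mul_cancel (Nat.gcd_dvd_left d d'), Nat.div_mul_cancel (Nat.gcd_dvd_right d d')]
  · -- right inverse
    rintro ⟨⟨a, b⟩, e⟩ hy
    simp only [Finset.mem_sigma, Finset.mem_filter, Finset.mem_product, Nat.mem_divisors] at hy
    obtain ⟨⟨-, hcop, -⟩, he⟩ := hy
    have he0 : 0 < e := Nat.pos_of_mem_divisors (Nat.mem_divisors.2 he)
    have hg : (a * e).gcd (b * e) = e := by rw [Nat.gcd_mul_right, hcop.gcd_eq_one, one_mul]
    simp only [hg, Nat.mul_div_cancel _ he0]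
  · -- the summands agree
    rintro ⟨d, d'⟩ -
    show F d d' = F (d / d.gcd d' * d.gcd d') (d' / d.gcd d' * d.gcd d')
    rw [Nat.div_mul_cancel (Nat.gcd_dvd_left d d'), Nat.div_mul_cancel (Nat.gcd_dvd_right d d')]

/-! ## The box form of a multiplicative unimodular character compresses to the difference set -/

/-- **Fejér compression of the box form.** If `χ` is multiplicative on positive integers and unimodular,
then for ANY symbol `w : ℝ → ℂ` and any `N`,
`Σ_{d,d' ∣ N} χ(d) conj χ(d') w(log d − log d') = Σ_{gcd(a,b)=1, ab ∣ N} τ(N/(ab)) · χ(a) conj χ(b) w(log a − log b)`: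
the summand depends only on the reduced fraction `d/d' = a/b`, and the fibre over `a/b` has `τ(N/(ab))` elements
(the Fejér multiplicity). [folklore] -/
theorem boxForm_eq_sum_coprime (N : ℕ) (χ : ℕ → ℂ) (w : ℝ → ℂ)
    (hχ : ∀ a e : ℕ, a ≠ 0 → e ≠ 0 → χ (a * e) = χ a * χ e)
    (hχ1 : ∀ e : ℕ, e ≠ 0 → χ e * conj (χ e) = 1) :
    ∑ d ∈ N.divisors, ∑ d' ∈ N.divisors, χ d * conj (χ d') * w (Real.log d - Real.log d') =
      ∑ a ∈ N.divisors, ∑ b ∈ N.divisors, if a.Coprime b ∧ a * b ∣ N then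
        ((N / (a * b)).divisors.card : ℂ) * (χ a * conj (χ b) * w (Real.log a - Real.log b)) else 0 := by
  rw [sum_divisors_sum_divisors_eq_sum_coprime N
    (fun d d' => χ d * conj (χ d') * w (Real.log d - Real.log d'))]
  refine Finset.sum_congr rfl fun a ha => Finset.sum_congr rfl fun b hb => ?_
  split_ifs with h
  · rw [← nsmul_eq_mul, ← Finset.sum_const]
    refine Finset.sum_congr rfl fun e he => ?_
    have ha0 : a ≠ 0 := (Nat.pos_of_mem_divisors ha).ne'
    have hb0 : b ≠ 0 := (Nat.pos_of_mem_divisors hb).ne'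
    have he0 : e ≠ 0 := (Nat.pos_of_mem_divisors he).ne'
    have hlog : Real.log ((a * e : ℕ) : ℝ) - Real.log ((b * e : ℕ) : ℝ) = Real.log a - Real.log b := by
      rw [Nat.cast_mul, Nat.cast_mul, Real.log_mul (by exact_mod_cast ha0) (by exact_mod_cast he0),
        Real.log_mul (by exact_mod_cast hb0) (by exact_mod_cast he0)]
      ring
    rw [hlog, hχ a e ha0 he0, hχ b e hb0 he0, map_mul]
    have : χ a * χ e * (conj (χ b) * conj (χ e)) = χ a * conj (χ b) * (χ e * conj (χ e)) := by ring
    rw [this, hχ1 e he0, mul_one]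
  · rfl

/-! ## The Bohr character `χ_θ(d) = exp(i Σ_p θ_p v_p(d))` -/

/-- The Bohr character is multiplicative on positive integers (additivity of `Nat.factorization`). [folklore] -/
theorem bohrChar_mul (S : Finset ℕ) (θ : ℕ → ℝ) {a e : ℕ} (ha : a ≠ 0) (he : e ≠ 0) :
    Complex.exp (I * ((∑ p ∈ S, θ p * ((a * e).factorization p : ℝ) : ℝ) : ℂ)) =
      Complex.exp (I * ((∑ p ∈ S, θ p * (a.factorization p : ℝ) : ℝ) : ℂ)) *
        Complex.exp (I * ((∑ p ∈ S, θ p * (e.factorization p : ℝ) : ℝ) : ℂ)) := by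
  have hsum : (∑ p ∈ S, θ p * ((a * e).factorization p : ℝ)) =
      ∑ p ∈ S, (θ p * (a.factorization p : ℝ) + θ p * (e.factorization p : ℝ)) := by
    refine Finset.sum_congr rfl fun p _ => ?_
    rw [Nat.factorization_mul ha he, Finsupp.add_apply, Nat.cast_add, mul_add]
  rw [hsum, Finset.sum_add_distrib, Complex.ofReal_add, mul_add, Complex.exp_add]

/-- The Bohr character is unimodular: `χ_θ(e) conj χ_θ(e) = 1`. [folklore] -/
theorem bohrChar_mul_conj (S : Finset ℕ) (θ : ℕ → ℝ) (e : ℕ) :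
    Complex.exp (I * ((∑ p ∈ S, θ p * (e.factorization p : ℝ) : ℝ) : ℂ)) *
      conj (Complex.exp (I * ((∑ p ∈ S, θ p * (e.factorization p : ℝ) : ℝ) : ℂ))) = 1 := by
  rw [Complex.mul_conj, Complex.normSq_eq_norm_sq, mul_comm I, Complex.norm_exp_ofReal_mul_I]
  simp

/-! ## Fejér weights on the prime box -/

/-- The factorization of the prime box `N = ∏_{p∈S} p^n`: `v_q(N) = n` for `q ∈ S`, else `0`. [folklore] -/
theorem factorization_primeBox {S : Finset ℕ} (hS : ∀ p ∈ S, p.Prime) (n q : ℕ) :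
    (∏ p ∈ S, p ^ n).factorization q = if q ∈ S then n else 0 := by
  rw [Nat.factorization_prod fun p hp => pow_ne_zero n (hS p hp).ne_zero, Finset.sum_apply']
  have h : ∀ p ∈ S, (p ^ n).factorization q = if p = q then n else 0 := fun p hp => by
    rw [(hS p hp).factorization_pow, Finsupp.single_apply]
  rw [Finset.sum_congr rfl h, Finset.sum_ite_eq']

/-- The prime box is nonzero. [folklore] -/
theorem primeBox_ne_zero {S : Finset ℕ} (hS : ∀ p ∈ S, p.Prime) (n : ℕ) : (∏ p ∈ S, p ^ n) ≠ 0 :=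
  Finset.prod_ne_zero_iff.2 fun p hp => pow_ne_zero n (hS p hp).ne_zero

/-- **Fejér weights.** For `m ∣ N = ∏_{p∈S} p^n` the number of divisors of `N/m` is
`∏_{p∈S} (n + 1 − v_p(m))`; with `m = ab`, `gcd(a,b) = 1`, `h = v(a) − v(b)` this is the Fejér kernel weight
`∏_p (n + 1 − |h_p|)`. [folklore] -/
theorem card_divisors_primeBox_div {S : Finset ℕ} (hS : ∀ p ∈ S, p.Prime) (n : ℕ) {m : ℕ}
    (hm : m ∣ ∏ p ∈ S, p ^ n) :
    ((∏ p ∈ S, p ^ n) / m).divisors.card = ∏ p ∈ S, (n + 1 - m.factorization p) := by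
  have hN0 : (∏ p ∈ S, p ^ n) ≠ 0 := primeBox_ne_zero hS n
  have hm0 : m ≠ 0 := ne_zero_of_dvd_ne_zero hN0 hm
  have hq0 : (∏ p ∈ S, p ^ n) / m ≠ 0 :=
    (Nat.div_pos (Nat.le_of_dvd (Nat.pos_of_ne_zero hN0) hm) (Nat.pos_of_ne_zero hm0)).ne'
  rw [Nat.card_divisors hq0]
  have hsub : ((∏ p ∈ S, p ^ n) / m).primeFactors ⊆ S := by
    intro p hp
    have hpP : p.Prime := Nat.prime_of_mem_primeFactors hp
    have hpd : p ∣ ∏ p ∈ S, p ^ n := dvd_trans (Nat.dvd_of_mem_primeFactors hp) (Nat.div_dvd_of_dvd hm)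
    obtain ⟨q, hq, hpq⟩ := (Prime.dvd_finsetProd_iff hpP.prime _).1 hpd
    have hpq' : p = q := (Nat.prime_dvd_prime_iff_eq hpP (hS q hq)).1 (hpP.dvd_of_dvd_pow hpq)
    exact hpq' ▸ hq
  rw [Finset.prod_subset hsub fun p _ hpn => by
    rw [Finsupp.notMem_support_iff.1 (by rwa [Nat.support_factorization]), zero_add]]
  refine Finset.prod_congr rfl fun p hp => ?_
  have hle : m.factorization p ≤ n := by
    have h := (Nat.factorization_le_iff_dvd hm0 hN0).2 hm p
    rwa [factorization_primeBox hS n p, if_pos hp] at h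
  rw [Nat.factorization_div hm, Finsupp.tsub_apply, factorization_primeBox hS n p, if_pos hp]
  omega

/-! ## The left-hand side of `stub_fejer`, verbatim, as a Fejér mean -/

/-- **The Dirichlet–Fejér identity for C⁺.** For every `ε`, every finite set of primes `S`, every `n` and `θ`,
the divisor-box form of the registered stub `stub_fejer` of line `Sketch` — with the comb symbol
`w_ε(x) = W(τ_x(φ_ε ⋆ φ̃_ε))` and the Bohr character `χ_θ` — equals the Fejér mean of the symbol over the
difference set: the sum over coprime pairs `(a, b)` with `ab ∣ N` (i.e. over `h = v(a) − v(b) ∈ [−n, n]^S`) of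
`∏_{p∈S}(n + 1 − v_p(a) − v_p(b)) · χ_θ(a) conj χ_θ(b) · w_ε(log a − log b)`
`= ∏_p (n+1−|h_p|) e^{i⟨θ,h⟩} w_ε(⟨h, log p⟩)`. (The hypothesis `0 < ε` of the stub is not needed for the
identity.) [folklore] -/
theorem stubFejer_lhs_eq_fejerSum : ∀ (ε : ℝ) (S : Finset ℕ), (∀ p ∈ S, p.Prime) → ∀ (n : ℕ) (θ : ℕ → ℝ),
    (∑ d ∈ (∏ p ∈ S, p ^ n).divisors, ∑ d' ∈ (∏ p ∈ S, p ^ n).divisors,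
      Complex.exp (I * ((∑ p ∈ S, θ p * (d.factorization p : ℝ) : ℝ) : ℂ)) *
        conj (Complex.exp (I * ((∑ p ∈ S, θ p * (d'.factorization p : ℝ) : ℝ) : ℂ))) *
        weilFunctional (weilTranslate
          (weilConv (fun t : ℝ => (ε : ℂ)⁻¹ * ((expNegInvGlue (1 - (t / ε) ^ 2) : ℝ) : ℂ))
            (weilReflect (fun t : ℝ => (ε : ℂ)⁻¹ * ((expNegInvGlue (1 - (t / ε) ^ 2) : ℝ) : ℂ))))
          (Real.log (d : ℝ) - Real.log (d' : ℝ)))) =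
    ∑ a ∈ (∏ p ∈ S, p ^ n).divisors, ∑ b ∈ (∏ p ∈ S, p ^ n).divisors,
      if a.Coprime b ∧ a * b ∣ ∏ p ∈ S, p ^ n then
        ((∏ p ∈ S, (n + 1 - (a.factorization p + b.factorization p)) : ℕ) : ℂ) *
          (Complex.exp (I * ((∑ p ∈ S, θ p * (a.factorization p : ℝ) : ℝ) : ℂ)) *
            conj (Complex.exp (I * ((∑ p ∈ S, θ p * (b.factorization p : ℝ) : ℝ) : ℂ))) *
            weilFunctional (weilTranslate
              (weilConv (fun t : ℝ => (ε : ℂ)⁻¹ * ((expNegInvGlue (1 - (t / ε) ^ 2) : ℝ) : ℂ))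
                (weilReflect (fun t : ℝ => (ε : ℂ)⁻¹ * ((expNegInvGlue (1 - (t / ε) ^ 2) : ℝ) : ℂ))))
              (Real.log (a : ℝ) - Real.log (b : ℝ))))
      else 0 := by
  intro ε S hS n θ
  refine (boxForm_eq_sum_coprime (∏ p ∈ S, p ^ n)
    (fun d : ℕ => Complex.exp (I * ((∑ p ∈ S, θ p * (d.factorization p : ℝ) : ℝ) : ℂ)))
    (fun x : ℝ => weilFunctional (weilTranslate
      (weilConv (fun t : ℝ => (ε : ℂ)⁻¹ * ((expNegInvGlue (1 - (t / ε) ^ 2) : ℝ) : ℂ))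
        (weilReflect (fun t : ℝ => (ε : ℂ)⁻¹ * ((expNegInvGlue (1 - (t / ε) ^ 2) : ℝ) : ℂ)))) x))
    (fun a e ha he => bohrChar_mul S θ ha he) (fun e _ => bohrChar_mul_conj S θ e)).trans ?_
  refine Finset.sum_congr rfl fun a ha => Finset.sum_congr rfl fun b hb => ?_
  split_ifs with h
  · have ha0 : a ≠ 0 := (Nat.pos_of_mem_divisors ha).ne'
    have hb0 : b ≠ 0 := (Nat.pos_of_mem_divisors hb).ne'
    rw [card_divisors_primeBox_div hS n h.2, Nat.factorization_mul ha0 hb0]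
    rfl
  · rfl

/-! ## The one-dimensional Dirichlet–Fejér identity, by induction on the box size
(`S = {p}`: the `(n+1) × (n+1)` difference table `Σ_{j,j' ≤ n} F(j − j')` is the Cesàro sum of the Dirichlet
layers `Σ_{|h| ≤ k} F(h)`, and counting the layers containing `h` gives the triangle weights `n + 1 − |h|`) -/

/-- The Dirichlet layer of size `n + 1`, split as the last row, the last column and the corner of the
`(n+2) × (n+2)` difference table: `Σ_{h=−(n+1)}^{n+1} F(h) = Σ_{j≤n} F(j − (n+1)) + (Σ_{j'≤n} F(n+1−j') + F(0))`.
[folklore] -/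
theorem dirichletLayer_eq {M : Type*} [AddCommMonoid M] (F : ℤ → M) (n : ℕ) :
    ∑ h ∈ Finset.Icc (-((n + 1 : ℕ) : ℤ)) ((n + 1 : ℕ) : ℤ), F h =
      ∑ j ∈ Finset.range (n + 1), F ((j : ℤ) - ((n + 1 : ℕ) : ℤ)) +
        (∑ j' ∈ Finset.range (n + 1), F (((n + 1 : ℕ) : ℤ) - j') +
          F (((n + 1 : ℕ) : ℤ) - ((n + 1 : ℕ) : ℤ))) := by
  rw [Int.Icc_eq_finset_map, Finset.sum_map]
  have hlen : (((n + 1 : ℕ) : ℤ) + 1 - -((n + 1 : ℕ) : ℤ)).toNat = (n + 1) + (n + 1 + 1) := by omega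
  rw [hlen, Finset.sum_range_add, Finset.sum_range_succ' _ (n + 1)]
  simp only [Function.Embedding.trans_apply, Nat.castEmbedding_apply, addLeftEmbedding_apply]
  have h1 : ∑ x ∈ Finset.range (n + 1), F (-((n + 1 : ℕ) : ℤ) + (x : ℕ)) =
      ∑ j ∈ Finset.range (n + 1), F ((j : ℤ) - ((n + 1 : ℕ) : ℤ)) :=
    Finset.sum_congr rfl fun j _ => by
      -- `-(n+1) + j` and `j - (n+1)` both unfold to `Int.subNatNat j (n+1)`
      congr 1
  have h2 : ∑ x ∈ Finset.range (n + 1), F (-((n + 1 : ℕ) : ℤ) + ((n + 1 + (x + 1) : ℕ) : ℤ)) =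
      ∑ j' ∈ Finset.range (n + 1), F (((n + 1 : ℕ) : ℤ) - (j' : ℕ)) := by
    rw [← Finset.sum_range_reflect (fun j' : ℕ => F (((n + 1 : ℕ) : ℤ) - (j' : ℕ))) (n + 1)]
    refine Finset.sum_congr rfl fun j hj => ?_
    have hj' := Finset.mem_range.1 hj
    congr 1
    omega
  have h3 : F (-((n + 1 : ℕ) : ℤ) + ((n + 1 + 0 : ℕ) : ℤ)) = F (((n + 1 : ℕ) : ℤ) - ((n + 1 : ℕ) : ℤ)) := by
    congr 1
  rw [h1, h2, h3]

/-- **Dirichlet–Fejér, step 1 (by induction on `n`).** The `(n+1) × (n+1)` difference table is the sum of the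
Dirichlet layers: `Σ_{j, j' ≤ n} F(j − j') = Σ_{k ≤ n} Σ_{|h| ≤ k} F(h)`. [folklore] -/
theorem sum_range_sum_range_eq_sum_dirichlet {M : Type*} [AddCommMonoid M] (F : ℤ → M) (n : ℕ) :
    ∑ j ∈ Finset.range (n + 1), ∑ j' ∈ Finset.range (n + 1), F ((j : ℤ) - j') =
      ∑ k ∈ Finset.range (n + 1), ∑ h ∈ Finset.Icc (-(k : ℤ)) k, F h := by
  induction n with
  | zero => simp
  | succ n ih =>
    rw [Finset.sum_range_succ (fun k => ∑ h ∈ Finset.Icc (-(k : ℤ)) k, F h) (n + 1), ← ih,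
      dirichletLayer_eq F n,
      Finset.sum_range_succ (fun j => ∑ j' ∈ Finset.range (n + 1 + 1), F ((j : ℤ) - j')) (n + 1)]
    simp_rw [Finset.sum_range_succ _ (n + 1)]
    rw [Finset.sum_add_distrib, add_assoc]

/-- **Dirichlet–Fejér, step 2 (counting layers).** `Σ_{k ≤ n} Σ_{|h| ≤ k} F(h) = Σ_{|h| ≤ n} (n + 1 − |h|) • F(h)`:
the layer `k` contains `h` iff `|h| ≤ k`, i.e. for `n + 1 − |h|` values of `k ≤ n`. [folklore] -/
theorem sum_dirichlet_eq_sum_fejer {M : Type*} [AddCommMonoid M] (F : ℤ → M) (n : ℕ) :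
    ∑ k ∈ Finset.range (n + 1), ∑ h ∈ Finset.Icc (-(k : ℤ)) k, F h =
      ∑ h ∈ Finset.Icc (-(n : ℤ)) n, (n + 1 - h.natAbs) • F h := by
  classical
  calc ∑ k ∈ Finset.range (n + 1), ∑ h ∈ Finset.Icc (-(k : ℤ)) k, F h
      = ∑ k ∈ Finset.range (n + 1), ∑ h ∈ Finset.Icc (-(n : ℤ)) n, if h.natAbs ≤ k then F h else 0 := by
        refine Finset.sum_congr rfl fun k hk => ?_
        have hk' := Finset.mem_range.1 hk
        rw [← Finset.sum_filter]
        congr 1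
        ext h
        simp only [Finset.mem_filter, Finset.mem_Icc]
        omega
    _ = ∑ h ∈ Finset.Icc (-(n : ℤ)) n, ∑ k ∈ Finset.range (n + 1), if h.natAbs ≤ k then F h else 0 :=
        Finset.sum_comm
    _ = ∑ h ∈ Finset.Icc (-(n : ℤ)) n, (n + 1 - h.natAbs) • F h := by
        refine Finset.sum_congr rfl fun h _ => ?_
        rw [← Finset.sum_filter, Finset.sum_const]
        congr 1
        have e : (Finset.range (n + 1)).filter (fun k => h.natAbs ≤ k) = Finset.Ico h.natAbs (n + 1) := by
          ext k
          simp only [Finset.mem_filter, Finset.mem_range, Finset.mem_Ico]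
          omega
        rw [e, Nat.card_Ico]

/-- **The Fejér identity** for the `(n+1) × (n+1)` difference table:
`Σ_{j, j' ≤ n} F(j − j') = Σ_{|h| ≤ n} (n + 1 − |h|) • F(h)` (so for `F(h) = e^{ihθ}` this is
`|Σ_{j ≤ n} e^{ijθ}|² = Σ_{|h|≤n} (n+1−|h|) e^{ihθ}`, the Fejér kernel). [folklore] -/
theorem sum_range_sum_range_eq_sum_fejer {M : Type*} [AddCommMonoid M] (F : ℤ → M) (n : ℕ) :
    ∑ j ∈ Finset.range (n + 1), ∑ j' ∈ Finset.range (n + 1), F ((j : ℤ) - j') =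
      ∑ h ∈ Finset.Icc (-(n : ℤ)) n, (n + 1 - h.natAbs) • F h :=
  (sum_range_sum_range_eq_sum_dirichlet F n).trans (sum_dirichlet_eq_sum_fejer F n)

/-- One entry of the single-prime table: for the nodes `p^j, p^{j'}` the Bohr character gives `e^{iθ(j − j')}`
and the log-difference is `(j − j') log p`. [folklore] -/
theorem singlePrime_entry {p : ℕ} (hp : p.Prime) (t : ℝ) (W : ℝ → ℂ) (j j' : ℕ) :
    Complex.exp (I * ((t * ((p ^ j).factorization p : ℝ) : ℝ) : ℂ)) *
        conj (Complex.exp (I * ((t * ((p ^ j').factorization p : ℝ) : ℝ) : ℂ))) *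
        W (Real.log ((p ^ j : ℕ) : ℝ) - Real.log ((p ^ j' : ℕ) : ℝ)) =
      Complex.exp (I * ((t * (((j : ℤ) - j' : ℤ) : ℝ) : ℝ) : ℂ)) *
        W ((((j : ℤ) - j' : ℤ) : ℝ) * Real.log (p : ℝ)) := by
  simp only [hp.factorization_pow, Finsupp.single_eq_same]
  have hlog : Real.log ((p ^ j : ℕ) : ℝ) - Real.log ((p ^ j' : ℕ) : ℝ) =
      (((j : ℤ) - j' : ℤ) : ℝ) * Real.log (p : ℝ) := by
    push_cast
    rw [Real.log_pow, Real.log_pow]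
    ring
  rw [hlog, ← Complex.exp_conj, map_mul, Complex.conj_I, Complex.conj_ofReal, ← Complex.exp_add]
  congr 2
  push_cast
  ring

/-- **Single-prime box form = classical Fejér mean**, for an arbitrary symbol `W`. For `S = {p}` the
divisor box is `{p^j : j ≤ n}` and
`Σ_{j,j' ≤ n} e^{iθ_p (j − j')} W((j − j') log p) = Σ_{|h| ≤ n} (n + 1 − |h|) e^{ihθ_p} W(h log p)`. [folklore] -/
theorem boxForm_single_prime (W : ℝ → ℂ) {p : ℕ} (hp : p.Prime) (n : ℕ) (θ : ℕ → ℝ) :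
    (∑ d ∈ (∏ q ∈ ({p} : Finset ℕ), q ^ n).divisors, ∑ d' ∈ (∏ q ∈ ({p} : Finset ℕ), q ^ n).divisors,
      Complex.exp (I * ((∑ q ∈ ({p} : Finset ℕ), θ q * (d.factorization q : ℝ) : ℝ) : ℂ)) *
        conj (Complex.exp (I * ((∑ q ∈ ({p} : Finset ℕ), θ q * (d'.factorization q : ℝ) : ℝ) : ℂ))) *
        W (Real.log (d : ℝ) - Real.log (d' : ℝ))) =
    ∑ h ∈ Finset.Icc (-(n : ℤ)) n, (n + 1 - h.natAbs) •
      (Complex.exp (I * ((θ p * (h : ℝ) : ℝ) : ℂ)) * W ((h : ℝ) * Real.log (p : ℝ))) := by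
  simp only [Finset.prod_singleton, Finset.sum_singleton]
  rw [Nat.sum_divisors_prime_pow hp]
  simp_rw [Nat.sum_divisors_prime_pow hp, singlePrime_entry hp (θ p) W]
  exact sum_range_sum_range_eq_sum_fejer
    (fun h : ℤ => Complex.exp (I * ((θ p * (h : ℝ) : ℝ) : ℂ)) * W ((h : ℝ) * Real.log (p : ℝ))) n

/-- **The single-prime slice of `stub_fejer` is the classical Fejér mean.** For `S = {p}` the divisor box is
`{p^j : j ≤ n}`, and the left-hand side of the stub is `Σ_{|h| ≤ n} (n + 1 − |h|) e^{ihθ_p} w_ε(h log p)`: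
the `n`-th Fejér (Cesàro) mean, at `θ_p`, of the Fourier series `Σ_h w_ε(h log p) e^{ihθ}` of the comb symbol
sampled on the lattice `(log p)ℤ` — i.e. the geometric-tower Toeplitz matrices `[w_ε((j−k) log p)]_{j,k ≤ n}`
(Disproof §7b, N6) tested against pure characters. [folklore] -/
theorem stubFejer_lhs_single_prime (ε : ℝ) {p : ℕ} (hp : p.Prime) (n : ℕ) (θ : ℕ → ℝ) :
    (∑ d ∈ (∏ q ∈ ({p} : Finset ℕ), q ^ n).divisors, ∑ d' ∈ (∏ q ∈ ({p} : Finset ℕ), q ^ n).divisors,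
      Complex.exp (I * ((∑ q ∈ ({p} : Finset ℕ), θ q * (d.factorization q : ℝ) : ℝ) : ℂ)) *
        conj (Complex.exp (I * ((∑ q ∈ ({p} : Finset ℕ), θ q * (d'.factorization q : ℝ) : ℝ) : ℂ))) *
        weilFunctional (weilTranslate
          (weilConv (fun t : ℝ => (ε : ℂ)⁻¹ * ((expNegInvGlue (1 - (t / ε) ^ 2) : ℝ) : ℂ))
            (weilReflect (fun t : ℝ => (ε : ℂ)⁻¹ * ((expNegInvGlue (1 - (t / ε) ^ 2) : ℝ) : ℂ))))
          (Real.log (d : ℝ) - Real.log (d' : ℝ)))) =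
    ∑ h ∈ Finset.Icc (-(n : ℤ)) n, (n + 1 - h.natAbs) •
      (Complex.exp (I * ((θ p * (h : ℝ) : ℝ) : ℂ)) *
        weilFunctional (weilTranslate
          (weilConv (fun t : ℝ => (ε : ℂ)⁻¹ * ((expNegInvGlue (1 - (t / ε) ^ 2) : ℝ) : ℂ))
            (weilReflect (fun t : ℝ => (ε : ℂ)⁻¹ * ((expNegInvGlue (1 - (t / ε) ^ 2) : ℝ) : ℂ))))
          ((h : ℝ) * Real.log (p : ℝ)))) :=
  boxForm_single_prime (fun x : ℝ => weilFunctional (weilTranslate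
    (weilConv (fun t : ℝ => (ε : ℂ)⁻¹ * ((expNegInvGlue (1 - (t / ε) ^ 2) : ℝ) : ℂ))
      (weilReflect (fun t : ℝ => (ε : ℂ)⁻¹ * ((expNegInvGlue (1 - (t / ε) ^ 2) : ℝ) : ℂ)))) x)) hp n θ

end Summit.RiemannHypothesis.RiemannHypothesis.Theorems.WeilCombFejerBoxIdentity

end
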